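import Mathlib
import HarnessLib
import Literature.NumberTheory.Irrationality.Zudilin2014.FirstTaleArithmetic
import Literature.NumberTheory.Irrationality.Zudilin2014.SecondTale
import Literature.NumberTheory.Transcendental.PeriodsWave0

/-!
# Rung L(2/5) — the point `(32,27,22,37 | 0,5,10,64)`, its forms, its Remark-5 partner and the names of its inputs

HONEST FRAMING: systematic search; no irrationality claim unless certified.  This file claims NO measure of `ζ(2)`.  It is
the L(2/5) twin of `Denom/TwoTaleD1Forms` (input F2 of the D1 programme `families/denom/D1-DESIGN-NOTE.md`; rung D1 = L(1/3)
is the tree theorem `TwoTaleD1Measure.zetaTwo_exponent_le_D1 : ExponentLE (zetaValue 2) 5.0205`).  Rung `s = 2/5` is the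
next rung of fam-measure g8's ladder `L(s)` (`rung_cost.log`: model `μ = 5.01980532`, the first rung moving the third
decimal; ladder infimum `5.019370`); it instantiates the tree's general first-tale objects of Zudilin 2014
(`Zudilin2014.formQZ`, `Zudilin2014.formP`; arXiv:1310.1526 = [Zudilin2014ZetaTwo], Prop. 1, §3) at the ladder point
`a = (32n+1, 27n+1, 22n+1, 37n+1)`, `b = (1, 5n+1, 10n+1, 64n+2)` (`= Lad(5n, 2n)` of `TwoTaleOmega.OmegaLadder`;
`a₄* = 37n+1`, `a₂* = 27n+1`, `d = 39n−1`, normaliser `D₃₇ₙ D₃₉ₙ`), names its Remark-5 partner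
`â = (79n+2; 27n+1, 32n+1, 37n+1)`, `b̂ = (37n+2; 15n+1, 59n+2, 64n+2)`, and NAMES the analytic inputs of the rung:
* `DecayL25 c` — `|qₙζ(2) − pₙ| ≤ e^{−cn}` eventually (design `C₀ = 71.44179775`, saddle of the tale-1 line profile);
* `CoeffRateL25 C₁` — `(1/n) log|qₙ| → C₁` (design `C₁ = 102.84494056`);
* `DecayTL25 c` — the partner's decay (not used on the (bmiss) path; named for the record).
PROVED here: the point data (`admissibleL25`, `amaxL25_eq`, `a2starL25_eq`, `dExpL25_eq`, `formQL25_cast`) and the normaliser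
`lcmNormaliserL25 = D₃₇ₙ D₃₉ₙ > 0`.  The inclusion input `InclusionL25`, the saving `savingProductL25` / `savingRateL25`
(`Denom/TwoTaleL25Saving`) and the CONDITIONAL measure theorem are in `Denom/TwoTaleL25Exponent`; this head carries no
dependence on the saving so that the analytic T-files and the digit tables import it alone.  DEFINITIONS ONLY + linear
integer arithmetic; nothing about `ζ(5)`.
-/

noncomputable section

open Filter Topology Finset
open Literature.NumberTheory.Transcendental
open Literature.NumberTheory.Irrationality
open Literature.NumberTheory.Irrationality.Zudilin2014

namespace Summit.KontsevichZagierPeriods.Zeta5Search.Denom.TwoTaleL25Forms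

/-- The slopes `(32, 27, 22, 37)` of `a_j = α_j n + 1`. -/
def slopeL25 : Fin 4 → ℕ := ![32, 27, 22, 37]

/-- `a = (32n+1, 27n+1, 22n+1, 37n+1)`. -/
def aL25 (n : ℕ) : Fin 4 → ℤ := fun i => (slopeL25 i : ℤ) * n + 1

/-- `b = (1, 5n+1, 10n+1, 64n+2)`. -/
def bL25 (n : ℕ) : Fin 4 → ℤ := ![1, 5 * (n : ℤ) + 1, 10 * (n : ℤ) + 1, 64 * (n : ℤ) + 2]

/-- `aL25_zero` (simp lemma). -/
@[simp] theorem aL25_zero (n : ℕ) : aL25 n 0 = 32 * n + 1 := by simp [aL25, slopeL25]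
/-- `aL25_one` (simp lemma). -/
@[simp] theorem aL25_one (n : ℕ) : aL25 n 1 = 27 * n + 1 := by simp [aL25, slopeL25]
/-- `aL25_two` (simp lemma). -/
@[simp] theorem aL25_two (n : ℕ) : aL25 n 2 = 22 * n + 1 := by simp [aL25, slopeL25]
/-- `aL25_three` (simp lemma). -/
@[simp] theorem aL25_three (n : ℕ) : aL25 n 3 = 37 * n + 1 := by simp [aL25, slopeL25]
/-- `bL25_zero` (simp lemma). -/
@[simp] theorem bL25_zero (n : ℕ) : bL25 n 0 = 1 := rfl
/-- `bL25_one` (simp lemma). -/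
@[simp] theorem bL25_one (n : ℕ) : bL25 n 1 = 5 * (n : ℤ) + 1 := rfl
/-- `bL25_two` (simp lemma). -/
@[simp] theorem bL25_two (n : ℕ) : bL25 n 2 = 10 * (n : ℤ) + 1 := rfl
/-- `bL25_three` (simp lemma). -/
@[simp] theorem bL25_three (n : ℕ) : bL25 n 3 = 64 * (n : ℤ) + 2 := rfl

/-- The point is admissible for `n ≥ 1` (eq. (cond1): `b_j ≤ a_i < b₄`; `d = 39n − 1 ≥ 0`). -/
theorem admissibleL25 {n : ℕ} (hn : 1 ≤ n) : Zudilin2014.Admissible (aL25 n) (bL25 n) where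
  lower j hj i := by
    have hi : (22 : ℤ) * n + 1 ≤ aL25 n i := by fin_cases i <;> simp <;> omega
    fin_cases j <;> simp at hj ⊢ <;> linarith
  upper i := by
    have hi : aL25 n i ≤ 37 * (n : ℤ) + 1 := by fin_cases i <;> simp <;> omega
    simp only [bL25_three]; linarith
  balance := by
    simp only [Fin.sum_univ_four, bL25_zero, bL25_one, bL25_two, bL25_three, aL25_zero, aL25_one, aL25_two,
      aL25_three]
    omega

/-- `a₄* = 37n + 1`. -/
theorem amaxL25_eq (n : ℕ) : amax (aL25 n) = 37 * (n : ℤ) + 1 := by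
  unfold amax; simp only [aL25_zero, aL25_one, aL25_two, aL25_three]; omega

/-- `a₂* = 27n + 1`. -/
theorem a2starL25_eq (n : ℕ) : a2star (aL25 n) = 27 * (n : ℤ) + 1 := by
  apply le_antisymm
  · unfold a2star
    refine sup'_le _ _ fun i _ => ?_
    by_cases hi : i = 1
    · subst hi
      calc minOthers (aL25 n) 1 ≤ aL25 n 2 := minOthers_le (aL25 n) (by decide)
        _ ≤ 27 * (n : ℤ) + 1 := by rw [aL25_two]; omega
    · calc minOthers (aL25 n) i ≤ aL25 n 1 := minOthers_le (aL25 n) (fun h => hi h.symm)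
        _ = 27 * (n : ℤ) + 1 := aL25_one n
  · have h : 27 * (n : ℤ) + 1 ≤ minOthers (aL25 n) 2 := by
      unfold minOthers
      refine le_inf' _ _ fun j hj => ?_
      have hj' : j ≠ 2 := (mem_erase.1 hj).1
      fin_cases j <;> simp at hj' ⊢ <;> omega
    exact h.trans (le_sup' (minOthers (aL25 n)) (mem_univ 2))

/-- `d = 39n − 1`. -/
theorem dExpL25_eq (n : ℕ) : dExp (aL25 n) (bL25 n) = 39 * n - 1 := by
  unfold dExp
  simp only [Fin.sum_univ_four, bL25_zero, bL25_one, bL25_two, bL25_three, aL25_zero, aL25_one, aL25_two, aL25_three]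
  omega

/-! ### The forms and the tale-1 inputs -/

/-- **`qₙ ∈ ℤ`** at L(2/5): `Zudilin2014.formQZ (aL25 n) (bL25 n)`. -/
def formQL25 (n : ℕ) : ℤ := Zudilin2014.formQZ (aL25 n) (bL25 n)

/-- **`pₙ ∈ ℚ`** at L(2/5): `Zudilin2014.formP (aL25 n) (bL25 n)`. -/
def formPL25 (n : ℕ) : ℚ := Zudilin2014.formP (aL25 n) (bL25 n)

/-- `qₙ` is the rational form `q(a,b)` of Prop. 1 (`FirstTaleArithmetic.formQ_eq_cast`). -/
theorem formQL25_cast {n : ℕ} (hn : 1 ≤ n) : (formQL25 n : ℚ) = Zudilin2014.formQ (aL25 n) (bL25 n) :=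
  (Zudilin2014.formQ_eq_cast (admissibleL25 hn)).symm

/-- **INPUT — decay** with constant `c`: `|qₙ ζ(2) − pₙ| ≤ e^{−cn}` eventually (design `C₀ = 71.44179775`). -/
@[conjecture] def DecayL25 (c : ℝ) : Prop :=
  ∀ᶠ n : ℕ in atTop, |(formQL25 n : ℝ) * zetaValue 2 - (formPL25 n : ℝ)| ≤ Real.exp (-(c * n))

/-- **INPUT — coefficient rate** `C₁`: `(1/n) log|qₙ| → C₁` (design `C₁ = 102.84494056`). -/
@[conjecture] def CoeffRateL25 (C₁ : ℝ) : Prop :=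
  Tendsto (fun n : ℕ => Real.log |(formQL25 n : ℝ)| / n) atTop (𝓝 C₁)

/-! ### The Remark-5 partner (second tale) -/

/-- The L(2/5) partner `â = (79n+2; 27n+1, 32n+1, 37n+1)` ([Zudilin2014ZetaTwo] Remark 5 at `(32,27,22,37 | 0,5,10,64)`). -/
def aTL25 (n : ℕ) : Fin 4 → ℤ := ![79 * (n : ℤ) + 2, 27 * (n : ℤ) + 1, 32 * (n : ℤ) + 1, 37 * (n : ℤ) + 1]

/-- The L(2/5) partner `b̂ = (37n+2; 15n+1, 59n+2, 64n+2)`. -/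
def bTL25 (n : ℕ) : Fin 4 → ℤ := ![37 * (n : ℤ) + 2, 15 * (n : ℤ) + 1, 59 * (n : ℤ) + 2, 64 * (n : ℤ) + 2]

/-- Component `aTL25 0 = 79n+2`. -/
@[simp] theorem aTL25_zero (n : ℕ) : aTL25 n 0 = 79 * (n : ℤ) + 2 := rfl
/-- Component `aTL25 1 = 27n+1`. -/
@[simp] theorem aTL25_one (n : ℕ) : aTL25 n 1 = 27 * (n : ℤ) + 1 := rfl
/-- Component `aTL25 2 = 32n+1`. -/
@[simp] theorem aTL25_two (n : ℕ) : aTL25 n 2 = 32 * (n : ℤ) + 1 := rfl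
/-- Component `aTL25 3 = 37n+1`. -/
@[simp] theorem aTL25_three (n : ℕ) : aTL25 n 3 = 37 * (n : ℤ) + 1 := rfl
/-- Component `bTL25 0 = 37n+2`. -/
@[simp] theorem bTL25_zero (n : ℕ) : bTL25 n 0 = 37 * (n : ℤ) + 2 := rfl
/-- Component `bTL25 1 = 15n+1`. -/
@[simp] theorem bTL25_one (n : ℕ) : bTL25 n 1 = 15 * (n : ℤ) + 1 := rfl
/-- Component `bTL25 2 = 59n+2`. -/
@[simp] theorem bTL25_two (n : ℕ) : bTL25 n 2 = 59 * (n : ℤ) + 2 := rfl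
/-- Component `bTL25 3 = 64n+2`. -/
@[simp] theorem bTL25_three (n : ℕ) : bTL25 n 3 = 64 * (n : ℤ) + 2 := rfl

/-- **INPUT — second-tale decay** with constant `c`: `|q̂ₙ ζ(2) − p̂ₙ| ≤ e^{−cn}` eventually at the partner (`formQT`/`formPT`
at `aTL25 n`, `bTL25 n`).  Not used on the (bmiss) path of the rung; named for the W1-type second derivation. -/
@[conjecture] def DecayTL25 (c : ℝ) : Prop :=
  ∀ᶠ n : ℕ in atTop,
    |(formQT (aTL25 n) (bTL25 n) : ℝ) * zetaValue 2 - (formPT (aTL25 n) (bTL25 n) : ℝ)| ≤ Real.exp (-(c * n))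

/-! ### The normaliser -/

/-- The normaliser `D₃₇ₙ · D₃₉ₙ` (Prop. 1 at the point: `M₁ = a₄* − 1 = 37n`, `M₂ = max(d, b₄ − a₂* − 1) = 39n − 1 ≤ 39n`). -/
def lcmNormaliserL25 (n : ℕ) : ℕ := Nat.lcmUpto (37 * n) * Nat.lcmUpto (39 * n)

/-- `D₃₇ₙ D₃₉ₙ > 0`. -/
theorem lcmNormaliserL25_pos (n : ℕ) : 0 < lcmNormaliserL25 n :=
  Nat.mul_pos (Nat.lcmUpto_pos _) (Nat.lcmUpto_pos _)

end Summit.KontsevichZagierPeriods.Zeta5Search.Denom.TwoTaleL25Forms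

end
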